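import Literature.AlgebraicGeometry.Motives.HodgeNumberUpperSemicontinuous
import Literature.AlgebraicGeometry.Motives.HodgeDecompositionIsInternalDischarge
import Literature.NumberTheory.Transcendental.ComplexFormsPullback
import HarnessLib

/-!
# Hodge numbers are eventually constant along almost holomorphic, almost isometric transports

Topic: Hodge theory in families (Voisin (2002), §9.3.2, Prop. 9.20 / Cor. 9.24; Kodaira (2005),
§7.2). Theorems only, no new facts.

Data: a compact Kähler reference `(M₀, g₀, o₀)` and compact Kähler `(M_i, g_i, o_i)` of the same
dimension with diffeomorphisms `Φ_i : M₀ → M_i` compatible with the orientations, whose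
differentials are almost isometric (`δ_i → 0`) and almost complex-linear (`κ_i → 0`) — the
situation of the nearby fibres of a holomorphic family (Ehresmann).

* `eventually_finrank_hodgePQ_le_of_transport` — **upper semicontinuity, filter form**:
  eventually `dim K^{p,q}(M_i) ≤ dim K^{p,q}(M₀)` (the tree's sequence statement
  `le_finrank_hodgePQ_of_transport` applied to an extracted subsequence).
* `eventually_finrank_hodgePQ_eq_of_transport` — **constancy** (Voisin, Prop. 9.20 with the
  Hodge decomposition, the argument of Cor. 9.24): eventually `dim K^{p,q}(M_i) = dim K^{p,q}(M₀)`
  for ALL `p + q = k` at once: `∑_{p+q=k} dim K^{p,q}(M_i) = b_k(M_i) = b_k(M₀)` (Hodge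
  decomposition `directSum_isInternal_hodgePQ`, and `Φ_i^*` is an isomorphism on de Rham
  cohomology), so termwise `≤` forces termwise `=`.

## References

* C. Voisin, *Hodge Theory and Complex Algebraic Geometry I*, CUP (2002), §9.3.2, Prop. 9.20,
  Cor. 9.24. [VoisinHodgeI2002]
* K. Kodaira, *Complex Manifolds and Deformation of Complex Structures* (2005), §7.2.
  [Kodaira2005]
-/

noncomputable section

open scoped Manifold ContDiff Topology InnerProductSpace
open Bundle Module Set Filter Finset
open Literature.Geometry.Kaehler Literature.NumberTheory.Transcendental
  Literature.AlgebraicGeometry.Motives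

namespace Literature.AlgebraicGeometry.HodgeTheory

-- `TangentSpace 𝓘(ℝ, E) x = E` silently, as in the tree's form files.
set_option backward.isDefEq.respectTransparency false

universe u v

variable {E₀ : Type*} [NormedAddCommGroup E₀] [NormedSpace ℂ E₀] [FiniteDimensional ℂ E₀]
  {M₀ : Type*} [TopologicalSpace M₀] [ChartedSpace E₀ M₀] [IsManifold 𝓘(ℝ, E₀) ∞ M₀]
  [IsManifold 𝓘(ℂ, E₀) ω M₀] [T2Space M₀] [CompactSpace M₀] {n : ℕ} [Fact (finrank ℝ E₀ = n)]
  [MeasurableSpace E₀] [BorelSpace E₀]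
  (g₀ : ContMDiffRiemannianMetric 𝓘(ℝ, E₀) ∞ E₀ (fun x : M₀ ↦ TangentSpace 𝓘(ℝ, E₀) x))
  (o₀ : (x : M₀) → Orientation ℝ (TangentSpace 𝓘(ℝ, E₀) x) (Fin n))

omit [FiniteDimensional ℂ E₀] [IsManifold 𝓘(ℂ, E₀) ω M₀] [T2Space M₀] [CompactSpace M₀]
  [MeasurableSpace E₀] [BorelSpace E₀] in
/-- **A diffeomorphism induces an isomorphism on complex de Rham cohomology**, hence preserves
`b_k = dim_ℂ H^k_dR(·; ℂ)` (functoriality `complexDeRhamCohomology.map_comp`, `map_id`).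
[folklore] -/
theorem finrank_complexDeRhamCohomology_eq_of_diffeomorph
    {E₁ : Type*} [NormedAddCommGroup E₁] [NormedSpace ℂ E₁] [FiniteDimensional ℂ E₁]
    {M₁ : Type*} [TopologicalSpace M₁] [ChartedSpace E₁ M₁] [IsManifold 𝓘(ℝ, E₁) ∞ M₁]
    (Φ : Diffeomorph 𝓘(ℝ, E₀) 𝓘(ℝ, E₁) M₀ M₁ ∞) (k : ℕ) :
    finrank ℂ (complexDeRhamCohomology E₁ M₁ k) = finrank ℂ (complexDeRhamCohomology E₀ M₀ k) := by
  -- `Φ^*` and `(Φ⁻¹)^*` are inverse to each other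
  let F := complexDeRhamCohomology.map E₀ Φ.contMDiff k
  let G := complexDeRhamCohomology.map E₁ Φ.symm.contMDiff k
  have hFG : F ∘ₗ G = LinearMap.id := by
    change complexDeRhamCohomology.map E₀ Φ.contMDiff k ∘ₗ
      complexDeRhamCohomology.map E₁ Φ.symm.contMDiff k = LinearMap.id
    rw [← complexDeRhamCohomology.map_comp Φ.symm.contMDiff Φ.contMDiff k,
      complexDeRhamCohomology.map_congr (Φ.symm.contMDiff.comp Φ.contMDiff) contMDiff_id
        (funext fun x ↦ Φ.symm_apply_apply x) k, complexDeRhamCohomology.map_id]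
  have hGF : G ∘ₗ F = LinearMap.id := by
    change complexDeRhamCohomology.map E₁ Φ.symm.contMDiff k ∘ₗ
      complexDeRhamCohomology.map E₀ Φ.contMDiff k = LinearMap.id
    rw [← complexDeRhamCohomology.map_comp Φ.contMDiff Φ.symm.contMDiff k,
      complexDeRhamCohomology.map_congr (Φ.contMDiff.comp Φ.symm.contMDiff) contMDiff_id
        (funext fun y ↦ Φ.apply_symm_apply y) k, complexDeRhamCohomology.map_id]
  let e : complexDeRhamCohomology E₁ M₁ k ≃ₗ[ℂ] complexDeRhamCohomology E₀ M₀ k :=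
    LinearEquiv.ofLinear F G hFG hGF
  exact e.finrank_eq

/-- **`∑_{p+q=k} dim K^{p,q} = b_k` on a compact Kähler manifold** (the Hodge decomposition
`directSum_isInternal_hodgePQ`, numerically). [cite: VoisinHodgeI2002, §6.1.3 (p. 142)] -/
theorem sum_finrank_hodgePQ_eq_finrank
    {E : Type*} [NormedAddCommGroup E] [NormedSpace ℂ E] [FiniteDimensional ℂ E]
    {M : Type*} [TopologicalSpace M] [ChartedSpace E M] [IsManifold 𝓘(ℝ, E) ∞ M]
    [IsManifold 𝓘(ℂ, E) ω M] [CompactSpace M] [T2Space M] [IsKaehlerManifold E M] (k : ℕ) :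
    ∑ pq ∈ antidiagonal k, finrank ℂ ↥(hodgePQ E M k pq.1 pq.2) =
      finrank ℂ (complexDeRhamCohomology E M k) := by
  haveI : Module.Finite ℂ (complexDeRhamCohomology E M k) :=
    complexDeRhamCohomology.finite_of_compactSpace E M k
  let e := LinearEquiv.ofBijective
    (DirectSum.coeLinearMap fun pq : ↥(antidiagonal k) ↦ hodgePQ E M k pq.1.1 pq.1.2)
    (directSum_isInternal_hodgePQ (E := E) (M := M) k)
  rw [← e.finrank_eq, Module.finrank_directSum, ← Finset.sum_coe_sort (antidiagonal k)]

/-- **Upper semicontinuity of `dim K^{p,q}`, filter form** (Voisin (2002), §9.3.2 Prop. 9.20):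
in the situation of `le_finrank_hodgePQ_of_transport` (see the module docstring), eventually
`dim K^{p,q}(M_i) ≤ dim K^{p,q}(M₀)`. [cite: VoisinHodgeI2002, §9.3.2 Prop. 9.20] -/
theorem eventually_finrank_hodgePQ_le_of_transport (hg₀ : g₀.toRiemannianMetric.IsKaehler)
    {k m : ℕ} (h : k + m = n) (p q : ℕ)
    (Em : ℕ → Type u) [∀ i, NormedAddCommGroup (Em i)] [∀ i, NormedSpace ℂ (Em i)]
    [∀ i, FiniteDimensional ℂ (Em i)] [∀ i, Fact (finrank ℝ (Em i) = n)]
    [∀ i, MeasurableSpace (Em i)] [∀ i, BorelSpace (Em i)]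
    (Mf : ℕ → Type v) [∀ i, TopologicalSpace (Mf i)] [∀ i, ChartedSpace (Em i) (Mf i)]
    [∀ i, IsManifold 𝓘(ℝ, Em i) ∞ (Mf i)] [∀ i, IsManifold 𝓘(ℂ, Em i) ω (Mf i)]
    [∀ i, T2Space (Mf i)] [∀ i, CompactSpace (Mf i)]
    (g : ∀ i, ContMDiffRiemannianMetric 𝓘(ℝ, Em i) ∞ (Em i) (fun y : Mf i ↦ TangentSpace 𝓘(ℝ, Em i) y))
    (hg : ∀ i, (g i).toRiemannianMetric.IsKaehler)
    (o : ∀ i, (y : Mf i) → Orientation ℝ (TangentSpace 𝓘(ℝ, Em i) y) (Fin n))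
    (Φ : ∀ i, Diffeomorph 𝓘(ℝ, E₀) 𝓘(ℝ, Em i) M₀ (Mf i) ∞)
    (δ κ : ℕ → ℝ) (hδ0 : ∀ i, 0 ≤ δ i) (hκ0 : ∀ i, 0 ≤ κ i)
    (hδ : Tendsto δ atTop (𝓝 0)) (hκ : Tendsto κ atTop (𝓝 0)) :
    letI : RiemannianBundle (fun x : M₀ ↦ TangentSpace 𝓘(ℝ, E₀) x) := ⟨g₀.toRiemannianMetric⟩
    letI : ∀ i, RiemannianBundle (fun y : Mf i ↦ TangentSpace 𝓘(ℝ, Em i) y) :=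
      fun i ↦ ⟨(g i).toRiemannianMetric⟩
    IsSmoothForm (riemannianVolumeForm o₀) → (∀ i, IsSmoothForm (riemannianVolumeForm (o i))) →
    ∀ (b : ∀ x : M₀, OrthonormalBasis (Fin n) ℝ (TangentSpace 𝓘(ℝ, E₀) x)),
      (∀ x, (b x).toBasis.orientation = o₀ x) →
      (∀ i x, Orientation.map (Fin n)
        ((Φ i).mfderivToContinuousLinearEquiv (by simp) x).toLinearEquiv (o₀ x) = o i (Φ i x)) →
      (∀ i x j l, |⟪mfderiv 𝓘(ℝ, E₀) 𝓘(ℝ, Em i) (Φ i) x (b x j),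
          mfderiv 𝓘(ℝ, E₀) 𝓘(ℝ, Em i) (Φ i) x (b x l)⟫_ℝ - (if j = l then 1 else 0)| ≤ δ i) →
      (∀ i x, ‖(tangentJ (Em i) (Φ i x)).comp (mfderiv 𝓘(ℝ, E₀) 𝓘(ℝ, Em i) (Φ i) x) -
          (mfderiv 𝓘(ℝ, E₀) 𝓘(ℝ, Em i) (Φ i) x).comp (tangentJ E₀ x)‖ ≤ κ i) →
      ∀ᶠ i in atTop, finrank ℂ ↥(hodgePQ (Em i) (Mf i) k p q) ≤ finrank ℂ ↥(hodgePQ E₀ M₀ k p q) := by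
  intro ho₀ ho b hb hΦ hT hJ
  by_contra hcon
  have hfreq : ∃ᶠ i in atTop,
      finrank ℂ ↥(hodgePQ E₀ M₀ k p q) + 1 ≤ finrank ℂ ↥(hodgePQ (Em i) (Mf i) k p q) := by
    rw [Filter.not_eventually] at hcon
    exact hcon.mono fun i hi ↦ by omega
  obtain ⟨φ, hφ, hφP⟩ := Filter.extraction_of_frequently_atTop hfreq
  have key := le_finrank_hodgePQ_of_transport g₀ o₀ hg₀ h p q (fun i ↦ Em (φ i))
    (fun i ↦ Mf (φ i)) (fun i ↦ g (φ i)) (fun i ↦ hg (φ i)) (fun i ↦ o (φ i)) (fun i ↦ Φ (φ i))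
    (δ ∘ φ) (κ ∘ φ) (fun i ↦ hδ0 _) (fun i ↦ hκ0 _) (hδ.comp hφ.tendsto_atTop)
    (hκ.comp hφ.tendsto_atTop) (N := finrank ℂ ↥(hodgePQ E₀ M₀ k p q) + 1) ho₀
    (fun i ↦ ho (φ i)) b hb (fun i ↦ hΦ (φ i)) (fun i ↦ hT (φ i)) (fun i ↦ hJ (φ i)) hφP
  omega

/-- **The Hodge numbers are eventually constant** along almost holomorphic, almost isometric
transports between compact Kähler manifolds (Voisin (2002), §9.3.2, Prop. 9.20 with the Hodge
decomposition; Cor. 9.24): eventually `dim K^{p,q}(M_i) = dim K^{p,q}(M₀)` for all `p + q = k`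
simultaneously. [cite: VoisinHodgeI2002, §9.3.2 Prop. 9.20, Cor. 9.24] -/
theorem eventually_finrank_hodgePQ_eq_of_transport (hg₀ : g₀.toRiemannianMetric.IsKaehler)
    {k m : ℕ} (h : k + m = n)
    (Em : ℕ → Type u) [∀ i, NormedAddCommGroup (Em i)] [∀ i, NormedSpace ℂ (Em i)]
    [∀ i, FiniteDimensional ℂ (Em i)] [∀ i, Fact (finrank ℝ (Em i) = n)]
    [∀ i, MeasurableSpace (Em i)] [∀ i, BorelSpace (Em i)]
    (Mf : ℕ → Type v) [∀ i, TopologicalSpace (Mf i)] [∀ i, ChartedSpace (Em i) (Mf i)]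
    [∀ i, IsManifold 𝓘(ℝ, Em i) ∞ (Mf i)] [∀ i, IsManifold 𝓘(ℂ, Em i) ω (Mf i)]
    [∀ i, T2Space (Mf i)] [∀ i, CompactSpace (Mf i)]
    (g : ∀ i, ContMDiffRiemannianMetric 𝓘(ℝ, Em i) ∞ (Em i) (fun y : Mf i ↦ TangentSpace 𝓘(ℝ, Em i) y))
    (hg : ∀ i, (g i).toRiemannianMetric.IsKaehler)
    (o : ∀ i, (y : Mf i) → Orientation ℝ (TangentSpace 𝓘(ℝ, Em i) y) (Fin n))
    (Φ : ∀ i, Diffeomorph 𝓘(ℝ, E₀) 𝓘(ℝ, Em i) M₀ (Mf i) ∞)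
    (δ κ : ℕ → ℝ) (hδ0 : ∀ i, 0 ≤ δ i) (hκ0 : ∀ i, 0 ≤ κ i)
    (hδ : Tendsto δ atTop (𝓝 0)) (hκ : Tendsto κ atTop (𝓝 0)) :
    letI : RiemannianBundle (fun x : M₀ ↦ TangentSpace 𝓘(ℝ, E₀) x) := ⟨g₀.toRiemannianMetric⟩
    letI : ∀ i, RiemannianBundle (fun y : Mf i ↦ TangentSpace 𝓘(ℝ, Em i) y) :=
      fun i ↦ ⟨(g i).toRiemannianMetric⟩
    IsSmoothForm (riemannianVolumeForm o₀) → (∀ i, IsSmoothForm (riemannianVolumeForm (o i))) →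
    ∀ (b : ∀ x : M₀, OrthonormalBasis (Fin n) ℝ (TangentSpace 𝓘(ℝ, E₀) x)),
      (∀ x, (b x).toBasis.orientation = o₀ x) →
      (∀ i x, Orientation.map (Fin n)
        ((Φ i).mfderivToContinuousLinearEquiv (by simp) x).toLinearEquiv (o₀ x) = o i (Φ i x)) →
      (∀ i x j l, |⟪mfderiv 𝓘(ℝ, E₀) 𝓘(ℝ, Em i) (Φ i) x (b x j),
          mfderiv 𝓘(ℝ, E₀) 𝓘(ℝ, Em i) (Φ i) x (b x l)⟫_ℝ - (if j = l then 1 else 0)| ≤ δ i) →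
      (∀ i x, ‖(tangentJ (Em i) (Φ i x)).comp (mfderiv 𝓘(ℝ, E₀) 𝓘(ℝ, Em i) (Φ i) x) -
          (mfderiv 𝓘(ℝ, E₀) 𝓘(ℝ, Em i) (Φ i) x).comp (tangentJ E₀ x)‖ ≤ κ i) →
      ∀ᶠ i in atTop, ∀ pq ∈ antidiagonal k,
        finrank ℂ ↥(hodgePQ (Em i) (Mf i) k pq.1 pq.2) = finrank ℂ ↥(hodgePQ E₀ M₀ k pq.1 pq.2) := by
  intro ho₀ ho b hb hΦ hT hJ
  -- termwise upper semicontinuity, for all types at once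
  have hle : ∀ᶠ i in atTop, ∀ pq ∈ antidiagonal k,
      finrank ℂ ↥(hodgePQ (Em i) (Mf i) k pq.1 pq.2) ≤ finrank ℂ ↥(hodgePQ E₀ M₀ k pq.1 pq.2) := by
    rw [Filter.eventually_all_finset]
    intro pq _
    exact eventually_finrank_hodgePQ_le_of_transport g₀ o₀ hg₀ h pq.1 pq.2 Em Mf g hg o Φ δ κ hδ0
      hκ0 hδ hκ ho₀ ho b hb hΦ hT hJ
  filter_upwards [hle] with i hi
  -- the sums agree: both are `b_k`
  haveI : IsKaehlerManifold E₀ M₀ := ⟨⟨g₀, hg₀⟩⟩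
  haveI : IsKaehlerManifold (Em i) (Mf i) := ⟨⟨g i, hg i⟩⟩
  have hsum : ∑ pq ∈ antidiagonal k, finrank ℂ ↥(hodgePQ (Em i) (Mf i) k pq.1 pq.2) =
      ∑ pq ∈ antidiagonal k, finrank ℂ ↥(hodgePQ E₀ M₀ k pq.1 pq.2) := by
    rw [sum_finrank_hodgePQ_eq_finrank, sum_finrank_hodgePQ_eq_finrank,
      finrank_complexDeRhamCohomology_eq_of_diffeomorph (Φ i) k]
  exact (Finset.sum_eq_sum_iff_of_le hi).1 hsum

end Literature.AlgebraicGeometry.HodgeTheory
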